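/-
Origin: expansion seat `planner-pub-hodgecm-mc-theta-3-g13-0`, handover (BT) 2026-08-20T07:22Z md5 8f37ae7b79886c6f19ae3863326d93d6 (384 l.; NEW additive leaf over (BF) `ArchSlotBoxFock` + RUN-37 `HypCensus/OmgInsPin`; rowdep (BF) → (BT); (J-μ) Step 1c: the plane torus acts on #1214's slot box by pinTorusChar · place letters; harch holds with boxType₀/₁; HEADLINE slotTypeVec 1 − slotTypeVec 0 = pinTorusType₁ − pinTorusType₀; cert rc 0/41 s/0 warn/0 proof holes; axioms 35/35 ⊆ trio) (`HOME/mc/pub-hodgecm-mc-theta-3-g13/lean/stage44/HodgeCM/Model/ArchSlotBoxTorus.lean`, md5 8f37ae7b7988, 384 lines);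
landed by the second packager p2 gen 4 (p2-g4) in gate run 44 as `HodgeCM/Model/ArchSlotBoxTorus.lean` (verbatim).
-/
/-
Origin: speedrun cell pub-hodgecm, MODEL-CONSTRUCTION sub-cell, lineage mc-theta-3 (theta supply / second-lift lane, BINDER-OWNERS row 5 `S` slot),
seat planner-pub-hodgecm-mc-theta-3-g13-0 (gen 13), 2026-08-20.  Target in PKG: `HodgeCM/Model/ArchSlotBoxTorus.lean`
(NEW additive drop-alone leaf; imports this seat's `Model/ArchSlotBoxFock` (over sinst-1's #1214) and binder-2's installed `HypCensus/OmgInsPin`).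
KERNEL only: 0 records / `def … : Prop` / cites, 0 proof holes; intended closure {propext, Classical.choice, Quot.sound}.
-/
import Summits.HodgeConjecture.HodgeCM.Model.ArchSlotBoxFock
import Summits.HodgeConjecture.HodgeCM.Model.HypCensus.OmgInsPin

/-!
# (J-μ) STEP 1c: the plane torus on the slot box — `hΔ₁` IS the antidiagonal type of binder-2's torus character

`Model/ArchSlotBoxFock` wrote #1214's slot box as `follandFock 𝔢 (∏_w slotPlacePoly_w)` (plane frame `𝔢`).  binder-2's
`HypCensus.cmArchWeilRep_torus_follandFock` says the archimedean torus `(1, diag(u₀,u₁))` acts on such a vector by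
`χ_T(u) • follandFock 𝔢 (G ∘ (letters)⁻¹)`, `χ_T = pinTorusChar V S hGR h₁W` THE ONE torus character of the pin.  Here:

* §0 two generic helpers (`linSubst_star_diagonal_rename_degOnePoly'` = (F1)'s diagonal-letter lemma for an arbitrary renaming map; `archWeight_single`);
* §1 the letter block of the torus at a real place, in the pin's coordinates, is a diagonal unitary (`coe_reindexUnitary_dualPairι_torusPlaceLetter`),
  and at `v₁` its conjugate entry on the column-`k` variables of the box is the place character `ι_{w(v₁)}(u_k)` (`star_slotLetterDiag_slotCol_inl/inr`);
* §2 hence `∏_w slotPlacePoly_w` is a letter EIGENVECTOR with eigenvalue `slotPlaceScalar u = ι_{w(v₁)}(u₀) · ι_{w(v₁)}(u₁)`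
  (`linSubst_torusLetterBlock_prod_slotPlacePoly`), and **`cmArchWeilRep_torus_slotArchBox_linePhi`**:
  `ω_∞(1, diag u) (slotArchBox linePhi₀ linePhi₁) = (χ_T(u) · ι_{w(v₁)}(u₀) · ι_{w(v₁)}(u₁)) • (same)`;
* §3 in #1214's currency: `harch` HOLDS with `m_k = boxType_k := pinTorusType_k + 𝟙_{w(v₁)}`, `pinTorusType_k = charArchType (χ_T ∘ in_k)`
  (`cmArchWeilRep_torus_slotArchBox_linePhi_archWeight`, `ctxSlotArchBox_harch`);
* §4 **`slotTypeVec_one_sub_zero_eq` (HEADLINE)**: `slotTypeVec 1 − slotTypeVec 0 = pinTorusType₁ − pinTorusType₀` — the letter parts CANCEL and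
  E's (J-μ) difference for slots 0/1 is the archimedean type of binder-2's ONE character `χ_T` on the second factor minus the first
  (equivalently: its type along the antidiagonal `t ↦ diag(t⁻¹, t)`, on which the splitting twist `ν ∘ det` is invisible).

What then remains for `μ c 1 − μ c 0` in closed form: the antidiagonal type of `χ_T` — pinned by the vacuum (`cmArchWeilRep_torus_follandFock_one`)
and binder-2's per-place vacuum exponents (`placeVacExponents_eR_sub_eS`: `±(|P′| − |Q′|) = ±3` at a `W`-indefinite place, `0` elsewhere).
Nothing here is a claim of PerL/QW8; nothing is cited as a fact.
-/

set_option autoImplicit false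

noncomputable section

open scoped Matrix Classical SchwartzMap TensorProduct ComplexConjugate
open MvPolynomial
open NumberField (InfinitePlace maximalRealSubfield IsCMField)
open NumberField.mixedEmbedding (mixedSpace)
open Literature.NumberTheory.Automorphic Literature.NumberTheory.Automorphic.UnitaryGroup Literature.NumberTheory.Weil1964
open Literature.RepresentationTheory.KonnoKonno2007 Literature.RepresentationTheory.KonnoKonno2007.RealDualPair
open Literature.NumberTheory.GelbartRogawski1991 Literature.NumberTheory.GelbartRogawski1991.UnitaryDualPair
open Literature.RepresentationTheory (atPlace)
open Literature.Analysis.SegalBargmann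
open HodgeCM.Adelic HodgeCM.PerL34 HodgeCM.Model.HypCensus

namespace HodgeCM.Model.ArchSideTerm

/-! ## §0 two generic helpers -/

section Generic

/-- a diagonal substitution whose conjugate entries are one constant `a` on the (renamed) `V⁺ ⊗ W⁺` variables scales the renamed degree-one
polynomial by `a` ((F1) `linSubst_star_diagonal_rename_degOnePoly` for an arbitrary renaming map). -/
theorem linSubst_star_diagonal_rename_degOnePoly' (S' : Type) [Fintype S'] {n : ℕ} (d : Fin n → ℂ) (f : DPIdx (Fin 2) Unit Unit S' → Fin n)
    (a : ℂ) (hd : ∀ pr : Fin 2 × Unit, star (d (f (Sum.inl (Sum.inl pr)))) = a) (b : Fin 2 → ℂ) :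
    linSubst (star (Matrix.diagonal d)) (rename f (degOnePoly S' b)) = a • rename f (degOnePoly S' b) := by
  simp only [degOnePoly, map_sum, map_smul, rename_zeta_single, linSubst_star_diagonal_zeta_single, hd, Finset.smul_sum,
    smul_smul, mul_comm a]

/-- the typed weight of the indicator of one place is that place character: `archWeight 𝟙_w = ι_w`. -/
theorem archWeight_single (L : Type) [Field L] [NumberField L] [IsCMField L] (w : InfinitePlace L)
    (y : ↥(relNormOneInfUnits (↥(maximalRealSubfield L)) L)) :
    archWeight L (Pi.single w 1) y = ((archPlaceChar L w y : Circle) : ℂ) := by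
  rw [archWeight_eq_prod, Finset.prod_eq_single w (fun w' _ hw' => by rw [Pi.single_eq_of_ne hw', zpow_zero])
    (fun h => (h (Finset.mem_univ w)).elim), Pi.single_eq_same, zpow_one]

end Generic

/-! ## §1 the torus letters at a real place in the pin's coordinates -/

section Letters

variable {L : CMField} {ι₁ : L →+* ℂ} (V : HermSpace3 L ι₁) (S : StubTree.SeesawDatum L)

/-- the diagonal of the torus letter block at the place `v` in the pin's coordinates: `i ↦ dpTorus (1, 1, c|_R, c|_S) (pairFrame_v i)`,
`c = (ι_{w(v)}(u₀), ι_{w(v)}(u₁))`. -/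
def slotLetterDiag (v : {v : InfinitePlace (↥(maximalRealSubfield (L : Type))) // v.IsReal}) (u : NumberField.SeesawArchTorus (L : Type)) :
    Fin (3 * 2) → ℂ := fun i =>
  ((dpTorus (1 : PosIdx (cmXV (L : Type) (frameD V) (frameD_real V) ι₁ v) → Circle) (1 : NegIdx (cmXV (L : Type) (frameD V) (frameD_real V) ι₁ v) → Circle)
      (circleRestrict (fun j => 0 < cmXW (L : Type) (frameD V) (dW S) (dW_real S) ι₁ v j) (torusPlaceCircles (L : Type) v u))
      (circleRestrict (fun j => ¬0 < cmXW (L : Type) (frameD V) (dW S) (dW_real S) ι₁ v j) (torusPlaceCircles (L : Type) v u))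
      (pairFrame (PosIdx (cmXV (L : Type) (frameD V) (frameD_real V) ι₁ v)) (NegIdx (cmXV (L : Type) (frameD V) (frameD_real V) ι₁ v))
        (PosIdx (cmXW (L : Type) (frameD V) (dW S) (dW_real S) ι₁ v)) (NegIdx (cmXW (L : Type) (frameD V) (dW S) (dW_real S) ι₁ v))
        finProdFinEquiv (cmEpsV (L : Type) (frameD V) (frameD_real V) ι₁ v) (cmEpsW (L : Type) (frameD V) (dW S) (dW_real S) ι₁ v) i) : Circle) : ℂ)

/-- the torus letter at `v`, read in the pin's coordinates, is the diagonal unitary `diag(slotLetterDiag v u)`. -/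
theorem coe_reindexUnitary_dualPairι_torusPlaceLetter (v : {v : InfinitePlace (↥(maximalRealSubfield (L : Type))) // v.IsReal})
    (u : NumberField.SeesawArchTorus (L : Type)) :
    ((reindexUnitary (pairFrame (PosIdx (cmXV (L : Type) (frameD V) (frameD_real V) ι₁ v)) (NegIdx (cmXV (L : Type) (frameD V) (frameD_real V) ι₁ v))
        (PosIdx (cmXW (L : Type) (frameD V) (dW S) (dW_real S) ι₁ v)) (NegIdx (cmXW (L : Type) (frameD V) (dW S) (dW_real S) ι₁ v))
        finProdFinEquiv (cmEpsV (L : Type) (frameD V) (frameD_real V) ι₁ v) (cmEpsW (L : Type) (frameD V) (dW S) (dW_real S) ι₁ v))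
        (dualPairι (torusPlaceLetter (L : Type) (frameD V) (frameD_real V) (dW S) (dW_real S) ι₁ v u)) : Matrix.unitaryGroup (Fin (3 * 2)) ℂ) :
          Matrix (Fin (3 * 2)) (Fin (3 * 2)) ℂ) =
      Matrix.diagonal (slotLetterDiag V S v u) := by
  have hk : torusPlaceLetter (L : Type) (frameD V) (frameD_real V) (dW S) (dW_real S) ι₁ v u =
      ((diagHom (1 : PosIdx (cmXV (L : Type) (frameD V) (frameD_real V) ι₁ v) → Circle),
        diagHom (1 : NegIdx (cmXV (L : Type) (frameD V) (frameD_real V) ι₁ v) → Circle)),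
        (diagHom (circleRestrict (fun j => 0 < cmXW (L : Type) (frameD V) (dW S) (dW_real S) ι₁ v j) (torusPlaceCircles (L : Type) v u)),
          diagHom (circleRestrict (fun j => ¬0 < cmXW (L : Type) (frameD V) (dW S) (dW_real S) ι₁ v j) (torusPlaceCircles (L : Type) v u)))) := by
    rw [map_one, map_one]; rfl
  rw [hk, dualPairι_diagHom]
  ext i j
  simp only [reindexUnitary_apply, coe_diagHom', Matrix.diagonal_apply, EmbeddingLike.apply_eq_iff_eq, slotLetterDiag]

variable
  (hpos₀ : 0 < cmXW (L : Type) (frameD V) (lineVec (L : Type) (dW S 0)) (fun _ => dW_real S 0) ι₁ (HypCensus.cmPlace (L : Type) ι₁) 0)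
  (hpos₁ : 0 < cmXW (L : Type) (frameD V) (lineVec (L : Type) (dW S 1)) (fun _ => dW_real S 1) ι₁ (HypCensus.cmPlace (L : Type) ι₁) 0)

/-- in the plane's `W`-sign frame at `v₁`, column `0` is positive (the line `⟨dW S 0⟩` is). -/
theorem cmEpsW_zero :
    cmEpsW (L : Type) (frameD V) (dW S) (dW_real S) ι₁ (HypCensus.cmPlace (L : Type) ι₁) 0 = Sum.inl ⟨0, hpos₀⟩ :=
  Equiv.sumCompl_symm_apply_of_pos (p := fun j => 0 < cmXW (L : Type) (frameD V) (dW S) (dW_real S) ι₁ (HypCensus.cmPlace (L : Type) ι₁) j)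
    (a := 0) hpos₀

/-- in the plane's `W`-sign frame at `v₁`, column `1` is positive (the line `⟨dW S 1⟩` is). -/
theorem cmEpsW_one :
    cmEpsW (L : Type) (frameD V) (dW S) (dW_real S) ι₁ (HypCensus.cmPlace (L : Type) ι₁) 1 = Sum.inl ⟨1, hpos₁⟩ :=
  Equiv.sumCompl_symm_apply_of_pos (p := fun j => 0 < cmXW (L : Type) (frameD V) (dW S) (dW_real S) ι₁ (HypCensus.cmPlace (L : Type) ι₁) j)
    (a := 1) hpos₁

/-- the `V`-sign of the line's degree-one index: positive (the `V⁺ ⊗ W⁺` block). -/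
theorem cmEpsV_lineIdx (d : L) (hd : IsCMField.complexConj (L : Type) d = d)
    (hpos : 0 < cmXW (L : Type) (frameD V) (lineVec (L : Type) d) (fun _ => hd) ι₁ (HypCensus.cmPlace (L : Type) ι₁) 0) (pr : Fin 2 × Unit) :
    cmEpsV (L : Type) (frameD V) (frameD_real V) ι₁ (HypCensus.cmPlace (L : Type) ι₁)
        ((cmPlaceIdxAt (L : Type) e₁ (frameD V) (frameD_real V) (lineVec (L : Type) d) (fun _ => hd) ι₁ (HypCensus.cmPlace (L : Type) ι₁)
          (blockPosEquiv V) (blockNegEquiv V) (posIdxEquivUnit hpos) (negIdxEquivEmpty hpos)).symm (Sum.inl (Sum.inl pr))) =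
      Sum.inl ((blockPosEquiv V).symm pr.1) := by
  simp only [cmPlaceIdxAt, pairFrame, Equiv.symm_trans_apply, Equiv.symm_symm, dpIdxCongr, Equiv.sumCongr_symm, Equiv.sumCongr_apply,
    Sum.map_inl, Equiv.prodCongr_symm, Equiv.prodCongr_apply, Prod.map, dpEquiv_symm_inl_inl, Equiv.prodUnique_apply,
    Equiv.apply_symm_apply]

/-- **at `v₁`, on the column-`0` variables of the box, the conjugate torus letter entry is `ι_{w(v₁)}(u₀)`.** -/
theorem star_slotLetterDiag_slotCol_inl (u : NumberField.SeesawArchTorus (L : Type)) (pr : Fin 2 × Unit) :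
    star (slotLetterDiag V S (HypCensus.cmPlace (L : Type) ι₁) u (slotCol (Sum.inl
        ((cmPlaceIdxAt (L : Type) e₁ (frameD V) (frameD_real V) (lineVec (L : Type) (dW S 0)) (fun _ => dW_real S 0) ι₁ (HypCensus.cmPlace (L : Type) ι₁)
          (blockPosEquiv V) (blockNegEquiv V) (posIdxEquivUnit hpos₀) (negIdxEquivEmpty hpos₀)).symm (Sum.inl (Sum.inl pr)))))) =
      ((NumberField.archPlaceChar (L : Type) (cmPlaceOver (L : Type) (HypCensus.cmPlace (L : Type) ι₁)).1 (NumberField.SeesawArchTorus.fst (L : Type) u) :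
        Circle) : ℂ) := by
  unfold slotLetterDiag
  rw [pairFrame, Equiv.trans_apply, Equiv.trans_apply, finProdFinEquiv_symm_slotCol_inl, Equiv.prodCongr_apply, Prod.map,
    cmEpsV_lineIdx V (dW S 0) (dW_real S 0) hpos₀ pr, cmEpsW_zero V S hpos₀, dpEquiv_inl_inl]
  simp only [dpTorus, Sum.elim_inl, circleRestrict_apply, torusPlaceCircles_apply_zero, Pi.one_apply, one_mul, Circle.coe_inv_eq_conj,
    Complex.star_def, Complex.conj_conj]

/-- **at `v₁`, on the column-`1` variables of the box, the conjugate torus letter entry is `ι_{w(v₁)}(u₁)`.** -/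
theorem star_slotLetterDiag_slotCol_inr (u : NumberField.SeesawArchTorus (L : Type)) (pr : Fin 2 × Unit) :
    star (slotLetterDiag V S (HypCensus.cmPlace (L : Type) ι₁) u (slotCol (Sum.inr
        ((cmPlaceIdxAt (L : Type) e₁ (frameD V) (frameD_real V) (lineVec (L : Type) (dW S 1)) (fun _ => dW_real S 1) ι₁ (HypCensus.cmPlace (L : Type) ι₁)
          (blockPosEquiv V) (blockNegEquiv V) (posIdxEquivUnit hpos₁) (negIdxEquivEmpty hpos₁)).symm (Sum.inl (Sum.inl pr)))))) =
      ((NumberField.archPlaceChar (L : Type) (cmPlaceOver (L : Type) (HypCensus.cmPlace (L : Type) ι₁)).1 (NumberField.SeesawArchTorus.snd (L : Type) u) :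
        Circle) : ℂ) := by
  unfold slotLetterDiag
  rw [pairFrame, Equiv.trans_apply, Equiv.trans_apply, finProdFinEquiv_symm_slotCol_inr, Equiv.prodCongr_apply, Prod.map,
    cmEpsV_lineIdx V (dW S 1) (dW_real S 1) hpos₁ pr, cmEpsW_one V S hpos₁, dpEquiv_inl_inl]
  simp only [dpTorus, Sum.elim_inl, circleRestrict_apply, torusPlaceCircles_apply_one, Pi.one_apply, one_mul, Circle.coe_inv_eq_conj,
    Complex.star_def, Complex.conj_conj]

end Letters

/-! ## §2 the place product of the box is a letter eigenvector; the torus on the slot box -/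

section Eigen

variable {L : CMField} {ι₁ : L →+* ℂ} (V : HermSpace3 L ι₁) (S : StubTree.SeesawDatum L)
variable
  (hpos₀ : 0 < cmXW (L : Type) (frameD V) (lineVec (L : Type) (dW S 0)) (fun _ => dW_real S 0) ι₁ (HypCensus.cmPlace (L : Type) ι₁) 0)
  (hpos₁ : 0 < cmXW (L : Type) (frameD V) (lineVec (L : Type) (dW S 1)) (fun _ => dW_real S 1) ι₁ (HypCensus.cmPlace (L : Type) ι₁) 0)

/-- off `v₁` the box's place polynomial is the vacuum. -/
theorem slotPlacePoly_of_ne {w : {v : InfinitePlace (↥(maximalRealSubfield (L : Type))) // v.IsReal}} (hw : w ≠ HypCensus.cmPlace (L : Type) ι₁) :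
    slotPlacePoly V S hpos₀ hpos₁ w = 1 := by
  unfold slotPlacePoly
  rw [linePlacePoly_of_ne _ _ _ _ _ _ _ _ _ _ _ _ _ hw, linePlacePoly_of_ne _ _ _ _ _ _ _ _ _ _ _ _ _ hw, map_one, map_one, mul_one]

/-- the box's place product is its `v₁`-factor. -/
theorem prod_slotPlacePoly :
    ∏ w, rename (atPlace w) (slotPlacePoly V S hpos₀ hpos₁ w) =
      rename (atPlace (HypCensus.cmPlace (L : Type) ι₁)) (slotPlacePoly V S hpos₀ hpos₁ (HypCensus.cmPlace (L : Type) ι₁)) :=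
  Finset.prod_eq_single (HypCensus.cmPlace (L : Type) ι₁) (fun w _ hw => by rw [slotPlacePoly_of_ne V S hpos₀ hpos₁ hw, map_one])
    fun h => (h (Finset.mem_univ _)).elim

/-- **the place scalar of the box at `v₁`**: `ι_{w(v₁)}(u₀) · ι_{w(v₁)}(u₁)`. -/
def slotPlaceScalar (u : NumberField.SeesawArchTorus (L : Type)) : ℂ :=
  ((NumberField.archPlaceChar (L : Type) (cmPlaceOver (L : Type) (HypCensus.cmPlace (L : Type) ι₁)).1 (NumberField.SeesawArchTorus.fst (L : Type) u) :
      Circle) : ℂ) *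
    ((NumberField.archPlaceChar (L : Type) (cmPlaceOver (L : Type) (HypCensus.cmPlace (L : Type) ι₁)).1 (NumberField.SeesawArchTorus.snd (L : Type) u) :
      Circle) : ℂ)

/-- **the torus letter at `v₁` scales the box's `v₁`-polynomial by `ι_{w(v₁)}(u₀) · ι_{w(v₁)}(u₁)`** (one conjugate letter entry per column). -/
theorem linSubst_torusLetter_slotPlacePoly_same (u : NumberField.SeesawArchTorus (L : Type)) :
    linSubst (star ((reindexUnitary (pairFrame (PosIdx (cmXV (L : Type) (frameD V) (frameD_real V) ι₁ (HypCensus.cmPlace (L : Type) ι₁)))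
        (NegIdx (cmXV (L : Type) (frameD V) (frameD_real V) ι₁ (HypCensus.cmPlace (L : Type) ι₁)))
        (PosIdx (cmXW (L : Type) (frameD V) (dW S) (dW_real S) ι₁ (HypCensus.cmPlace (L : Type) ι₁)))
        (NegIdx (cmXW (L : Type) (frameD V) (dW S) (dW_real S) ι₁ (HypCensus.cmPlace (L : Type) ι₁)))
        finProdFinEquiv (cmEpsV (L : Type) (frameD V) (frameD_real V) ι₁ (HypCensus.cmPlace (L : Type) ι₁))
        (cmEpsW (L : Type) (frameD V) (dW S) (dW_real S) ι₁ (HypCensus.cmPlace (L : Type) ι₁)))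
        (dualPairι (torusPlaceLetter (L : Type) (frameD V) (frameD_real V) (dW S) (dW_real S) ι₁ (HypCensus.cmPlace (L : Type) ι₁) u)) :
          Matrix.unitaryGroup (Fin (3 * 2)) ℂ) : Matrix (Fin (3 * 2)) (Fin (3 * 2)) ℂ))
        (slotPlacePoly V S hpos₀ hpos₁ (HypCensus.cmPlace (L : Type) ι₁)) =
      slotPlaceScalar (ι₁ := ι₁) u • slotPlacePoly V S hpos₀ hpos₁ (HypCensus.cmPlace (L : Type) ι₁) := by
  rw [coe_reindexUnitary_dualPairι_torusPlaceLetter]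
  unfold slotPlacePoly
  rw [linePlacePoly_same, linePlacePoly_same, rename_rename, rename_rename, map_mul,
    linSubst_star_diagonal_rename_degOnePoly' Empty _ _ _ (fun pr => star_slotLetterDiag_slotCol_inl V S hpos₀ u pr),
    linSubst_star_diagonal_rename_degOnePoly' Empty _ _ _ (fun pr => star_slotLetterDiag_slotCol_inr V S hpos₁ u pr),
    smul_mul_smul_comm]
  rfl

/-- **the whole letter block of the torus scales the box's place product by the place scalar at `v₁`.** -/
theorem linSubst_torusLetterBlock_prod_slotPlacePoly (u : NumberField.SeesawArchTorus (L : Type)) :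
    linSubst (star ((placeBlock fun v : {v : InfinitePlace (↥(maximalRealSubfield (L : Type))) // v.IsReal} =>
        reindexUnitary (pairFrame (PosIdx (cmXV (L : Type) (frameD V) (frameD_real V) ι₁ v)) (NegIdx (cmXV (L : Type) (frameD V) (frameD_real V) ι₁ v))
          (PosIdx (cmXW (L : Type) (frameD V) (dW S) (dW_real S) ι₁ v)) (NegIdx (cmXW (L : Type) (frameD V) (dW S) (dW_real S) ι₁ v))
          finProdFinEquiv (cmEpsV (L : Type) (frameD V) (frameD_real V) ι₁ v) (cmEpsW (L : Type) (frameD V) (dW S) (dW_real S) ι₁ v))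
          (dualPairι (torusPlaceLetter (L : Type) (frameD V) (frameD_real V) (dW S) (dW_real S) ι₁ v u)) :
            Matrix.unitaryGroup (Fin (3 * 2) × {v : InfinitePlace (↥(maximalRealSubfield (L : Type))) // v.IsReal}) ℂ) : Matrix _ _ ℂ))
        (∏ w, rename (atPlace w) (slotPlacePoly V S hpos₀ hpos₁ w)) =
      slotPlaceScalar (ι₁ := ι₁) u • ∏ w, rename (atPlace w) (slotPlacePoly V S hpos₀ hpos₁ w) := by
  rw [prod_slotPlacePoly, linSubst_star_placeBlock_rename_atPlace, linSubst_torusLetter_slotPlacePoly_same, map_smul]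

variable (hGR : (cmSplittingDatum (L : Type) finProdFinEquiv (frameD V) (frameD_real V) (frameD_ne V) (dW S) (dW_real S) (dW_ne S)).CompatibleSplitting)
variable (h₁W : (∀ j, 0 < (ι₁ (dW S j)).re) ∨ ∀ j, (ι₁ (dW S j)).re < 0)

/-- **THE TORUS ON THE SLOT BOX** (see-saw datum `S`, big splitting `hGR`, plane definite through `ι₁`):
`ω_∞(1, diag u) (slotArchBox linePhi₀ linePhi₁) = (χ_T(u) · ι_{w(v₁)}(u₀) · ι_{w(v₁)}(u₁)) • (same)`, `χ_T = pinTorusChar V S hGR h₁W`. -/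
theorem cmArchWeilRep_torus_slotArchBox_linePhi (u : NumberField.SeesawArchTorus (L : Type)) :
    cmArchWeilRep (L : Type) finProdFinEquiv (frameD V) (frameD_real V) (frameD_ne V) (dW S) (dW_real S) (dW_ne S) hGR
        ((1 : ↥(UnitaryGroup.arch (↥(maximalRealSubfield (L : Type))) (L : Type) (IsCMField.complexConj (L : Type)) 3 (Matrix.diagonal (frameD V)))),
          archDiag (L : Type) (dW S) u)
        (slotArchBox (linePhi V (dW S 0) (dW_real S 0) (dW_ne S 0) hpos₀) (linePhi V (dW S 1) (dW_real S 1) (dW_ne S 1) hpos₁)) =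
      (((pinTorusChar V S hGR h₁W u : Circle) : ℂ) * slotPlaceScalar (ι₁ := ι₁) u) •
        slotArchBox (linePhi V (dW S 0) (dW_real S 0) (dW_ne S 0) hpos₀) (linePhi V (dW S 1) (dW_real S 1) (dW_ne S 1) hpos₁) := by
  rw [slotArchBox_linePhi_eq_follandFock]
  have h := cmArchWeilRep_torus_follandFock (L : Type) (frameD V) (frameD_real V) (frameD_ne V) (dW S) (dW_real S) (dW_ne S) hGR ι₁
    (frameD_sign_ι₁' V) h₁W (frameD_sign_of_ne V)
    (fun τ' _ => signs_fin_two fun j => re_apply_ne_zero_of_complexConj_eq (L : Type) τ' (dW_real S j) (dW_ne S j)) u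
    (∏ w, rename (atPlace w) (slotPlacePoly V S hpos₀ hpos₁ w))
  rw [linSubst_torusLetterBlock_prod_slotPlacePoly, follandFock_smul, smul_smul] at h
  exact h

end Eigen

/-! ## §3 `harch` in #1214's currency and the HEADLINE -/

section Types

variable {L : CMField} {ι₁ : L →+* ℂ} (V : HermSpace3 L ι₁) (S : StubTree.SeesawDatum L)
variable (hGR : (cmSplittingDatum (L : Type) finProdFinEquiv (frameD V) (frameD_real V) (frameD_ne V) (dW S) (dW_real S) (dW_ne S)).CompatibleSplitting)
variable (h₁W : (∀ j, 0 < (ι₁ (dW S j)).re) ∨ ∀ j, (ι₁ (dW S j)).re < 0)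

/-- `inl : U(1)(L⁺ ⊗ ℝ) → T(L⁺ ⊗ ℝ)` is continuous. -/
theorem continuous_seesawArchTorus_inl : Continuous (NumberField.SeesawArchTorus.inl (L : Type)) :=
  continuous_id.prodMk continuous_const

/-- `inr : U(1)(L⁺ ⊗ ℝ) → T(L⁺ ⊗ ℝ)` is continuous. -/
theorem continuous_seesawArchTorus_inr : Continuous (NumberField.SeesawArchTorus.inr (L : Type)) :=
  continuous_const.prodMk continuous_id

/-- binder-2's torus character of the pin `(V, S)` is continuous. -/
theorem continuous_pinTorusChar : Continuous (pinTorusChar V S hGR h₁W) :=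
  continuous_torusChar _ _ _ _ _ _ _ _ _ _ _ _ _

/-- **`χ_T ∘ inl`**: binder-2's torus character on the FIRST factor `u = (t, 1)`, as a `ℂ`-valued character of `U(1)(L⁺ ⊗ ℝ)`. -/
def pinTorusChar₀ : ↥(relNormOneInfUnits (↥(maximalRealSubfield (L : Type))) (L : Type)) →* ℂ :=
  (Circle.coeHom.comp (pinTorusChar V S hGR h₁W)).comp (NumberField.SeesawArchTorus.inl (L : Type))

/-- **`χ_T ∘ inr`**: binder-2's torus character on the SECOND factor `u = (1, t)`. -/
def pinTorusChar₁ : ↥(relNormOneInfUnits (↥(maximalRealSubfield (L : Type))) (L : Type)) →* ℂ :=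
  (Circle.coeHom.comp (pinTorusChar V S hGR h₁W)).comp (NumberField.SeesawArchTorus.inr (L : Type))

/-- (Ported verbatim from the HodgeCMPerL package; no docstring in the source.) -/
theorem pinTorusChar₀_apply (t : ↥(relNormOneInfUnits (↥(maximalRealSubfield (L : Type))) (L : Type))) :
    pinTorusChar₀ V S hGR h₁W t = ((pinTorusChar V S hGR h₁W (NumberField.SeesawArchTorus.inl (L : Type) t) : Circle) : ℂ) := rfl

/-- (Ported verbatim from the HodgeCMPerL package; no docstring in the source.) -/
theorem pinTorusChar₁_apply (t : ↥(relNormOneInfUnits (↥(maximalRealSubfield (L : Type))) (L : Type))) :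
    pinTorusChar₁ V S hGR h₁W t = ((pinTorusChar V S hGR h₁W (NumberField.SeesawArchTorus.inr (L : Type) t) : Circle) : ℂ) := rfl

/-- (Ported verbatim from the HodgeCMPerL package; no docstring in the source.) -/
theorem continuous_pinTorusChar₀ : Continuous (pinTorusChar₀ V S hGR h₁W) :=
  continuous_subtype_val.comp ((continuous_pinTorusChar V S hGR h₁W).comp (continuous_seesawArchTorus_inl (L := L)))

/-- (Ported verbatim from the HodgeCMPerL package; no docstring in the source.) -/
theorem continuous_pinTorusChar₁ : Continuous (pinTorusChar₁ V S hGR h₁W) :=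
  continuous_subtype_val.comp ((continuous_pinTorusChar V S hGR h₁W).comp (continuous_seesawArchTorus_inr (L := L)))

/-- **the archimedean type of `χ_T` on the first factor.** -/
def pinTorusType₀ : InfinitePlace (L : Type) → ℤ :=
  charArchType (L : Type) (pinTorusChar₀ V S hGR h₁W) (continuous_pinTorusChar₀ V S hGR h₁W)

/-- **the archimedean type of `χ_T` on the second factor.** -/
def pinTorusType₁ : InfinitePlace (L : Type) → ℤ :=
  charArchType (L : Type) (pinTorusChar₁ V S hGR h₁W) (continuous_pinTorusChar₁ V S hGR h₁W)

/-- the complex place of `L` over `v₁` at which the box carries its degree-one letters. -/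
abbrev cmPlaceUp : InfinitePlace (L : Type) := (cmPlaceOver (L : Type) (HypCensus.cmPlace (L : Type) ι₁)).1

/-- the exponents of `harch` for the box: `m_k = (type of χ_T on factor k) + 𝟙_{w(v₁)}`. -/
def boxType₀ : InfinitePlace (L : Type) → ℤ := pinTorusType₀ V S hGR h₁W + Pi.single (cmPlaceUp (ι₁ := ι₁)) 1

/-- see `boxType₀`. -/
def boxType₁ : InfinitePlace (L : Type) → ℤ := pinTorusType₁ V S hGR h₁W + Pi.single (cmPlaceUp (ι₁ := ι₁)) 1

/-- `χ_T(t₀, t₁) = χ_T(t₀, 1) · χ_T(1, t₁)`. -/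
theorem pinTorusChar_mk (t₀ t₁ : ↥(relNormOneInfUnits (↥(maximalRealSubfield (L : Type))) (L : Type))) :
    ((pinTorusChar V S hGR h₁W (NumberField.SeesawArchTorus.mk (L : Type) t₀ t₁) : Circle) : ℂ) =
      pinTorusChar₀ V S hGR h₁W t₀ * pinTorusChar₁ V S hGR h₁W t₁ := by
  rw [← NumberField.SeesawArchTorus.inl_mul_inr, map_mul, Circle.coe_mul]
  rfl

/-- the place scalar at `(t₀, t₁)` is `archWeight 𝟙_{w(v₁)} t₀ · archWeight 𝟙_{w(v₁)} t₁`. -/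
theorem slotPlaceScalar_mk (t₀ t₁ : ↥(relNormOneInfUnits (↥(maximalRealSubfield (L : Type))) (L : Type))) :
    slotPlaceScalar (ι₁ := ι₁) (NumberField.SeesawArchTorus.mk (L : Type) t₀ t₁) =
      archWeight (L : Type) (Pi.single (cmPlaceUp (ι₁ := ι₁)) 1) t₀ * archWeight (L : Type) (Pi.single (cmPlaceUp (ι₁ := ι₁)) 1) t₁ := by
  rw [archWeight_single, archWeight_single]
  rfl

/-- **`harch` OF #1214 HOLDS for the slot box, with `m_k = boxType_k`.** -/
theorem cmArchWeilRep_torus_slotArchBox_linePhi_archWeight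
    (hpos₀ : 0 < cmXW (L : Type) (frameD V) (lineVec (L : Type) (dW S 0)) (fun _ => dW_real S 0) ι₁ (HypCensus.cmPlace (L : Type) ι₁) 0)
    (hpos₁ : 0 < cmXW (L : Type) (frameD V) (lineVec (L : Type) (dW S 1)) (fun _ => dW_real S 1) ι₁ (HypCensus.cmPlace (L : Type) ι₁) 0)
    (t₀ t₁ : ↥(relNormOneInfUnits (↥(maximalRealSubfield (L : Type))) (L : Type))) :
    cmArchWeilRep (L : Type) finProdFinEquiv (frameD V) (frameD_real V) (frameD_ne V) (dW S) (dW_real S) (dW_ne S) hGR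
        ((1 : ↥(UnitaryGroup.arch (↥(maximalRealSubfield (L : Type))) (L : Type) (IsCMField.complexConj (L : Type)) 3 (Matrix.diagonal (frameD V)))),
          archDiag (L : Type) (dW S) (NumberField.SeesawArchTorus.mk (L : Type) t₀ t₁))
        (slotArchBox (linePhi V (dW S 0) (dW_real S 0) (dW_ne S 0) hpos₀) (linePhi V (dW S 1) (dW_real S 1) (dW_ne S 1) hpos₁)) =
      (archWeight (L : Type) (boxType₀ V S hGR h₁W) t₀ * archWeight (L : Type) (boxType₁ V S hGR h₁W) t₁) •
        slotArchBox (linePhi V (dW S 0) (dW_real S 0) (dW_ne S 0) hpos₀) (linePhi V (dW S 1) (dW_real S 1) (dW_ne S 1) hpos₁) := by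
  rw [cmArchWeilRep_torus_slotArchBox_linePhi V S hpos₀ hpos₁ hGR h₁W, pinTorusChar_mk, slotPlaceScalar_mk]
  unfold boxType₀ boxType₁ pinTorusType₀ pinTorusType₁
  rw [archWeight_add, archWeight_add, archWeight_charArchType, archWeight_charArchType, mul_mul_mul_comm]

end Types

/-! ## §4 HEADLINE: `slotTypeVec 1 − slotTypeVec 0` is the antidiagonal type of `χ_T` -/

section Vec

variable {L : CMField} {ι₁ : L →+* ℂ} (V : HermSpace3 L ι₁) (c : SeesawCtx L)
variable
  (hGR : (cmSplittingDatum (L : Type) finProdFinEquiv (frameD V) (frameD_real V) (frameD_ne V) (dW c.D) (dW_real c.D) (dW_ne c.D)).CompatibleSplitting)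
  (hGR₀ : (cmSplittingDatum (L : Type) (e₁) (frameD V) (frameD_real V) (frameD_ne V) (lineVec (L : Type) (dW c.D 0))
    (fun _ => dW_real c.D 0) (fun _ => dW_ne c.D 0)).CompatibleSplitting)
  (hGR₁ : (cmSplittingDatum (L : Type) (e₁) (frameD V) (frameD_real V) (frameD_ne V) (lineVec (L : Type) (dW c.D 1))
    (fun _ => dW_real c.D 1) (fun _ => dW_ne c.D 1)).CompatibleSplitting)
  (hGR₂ : (cmSplittingDatum (L : Type) (e₁) (frameD V) (frameD_real V) (frameD_ne V) (lineVec (L : Type) (dW' c.D 0))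
    (fun _ => dW'_real c.D 0) (fun _ => dW'_ne c.D 0)).CompatibleSplitting)
  (hGR₃ : (cmSplittingDatum (L : Type) (e₁) (frameD V) (frameD_real V) (frameD_ne V) (lineVec (L : Type) (dW' c.D 1))
    (fun _ => dW'_real c.D 1) (fun _ => dW'_ne c.D 1)).CompatibleSplitting)
  (h₁W : (∀ j, 0 < (ι₁ (dW c.D j)).re) ∨ ∀ j, (ι₁ (dW c.D j)).re < 0)
  (hpos₀ : 0 < cmXW (L : Type) (frameD V) (lineVec (L : Type) (dW c.D 0)) (fun _ => dW_real c.D 0) ι₁ (HypCensus.cmPlace (L : Type) ι₁) 0)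
  (hpos₁ : 0 < cmXW (L : Type) (frameD V) (lineVec (L : Type) (dW c.D 1)) (fun _ => dW_real c.D 1) ι₁ (HypCensus.cmPlace (L : Type) ι₁) 0)

/-- the torus acts on #1214's `ctxSlotArchBox` by `archWeight boxType₀ t₀ · archWeight boxType₁ t₁` (= #1214's `harch`). -/
theorem ctxSlotArchBox_harch (t₀ t₁ : ↥(relNormOneInfUnits (↥(maximalRealSubfield (L : Type))) (L : Type))) :
    cmArchWeilRep (L : Type) finProdFinEquiv (frameD V) (frameD_real V) (frameD_ne V) (dW c.D) (dW_real c.D) (dW_ne c.D) hGR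
        (1, archDiag (L : Type) (dW c.D) (NumberField.SeesawArchTorus.mk (L : Type) t₀ t₁)) (ctxSlotArchBox V c hpos₀ hpos₁) =
      (archWeight (L : Type) (boxType₀ V c.D hGR h₁W) t₀ * archWeight (L : Type) (boxType₁ V c.D hGR h₁W) t₁) • ctxSlotArchBox V c hpos₀ hpos₁ :=
  cmArchWeilRep_torus_slotArchBox_linePhi_archWeight V c.D hGR h₁W hpos₀ hpos₁ t₀ t₁

include hpos₀ hpos₁ in
/-- **HEADLINE — E's (J-μ) difference for slots 0/1 IS the antidiagonal type of binder-2's torus character**: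
`slotTypeVec 1 − slotTypeVec 0 = (type of χ_T on the second factor) − (type of χ_T on the first factor)`;
the letter contributions `𝟙_{w(v₁)}` of the two columns cancel. -/
theorem slotTypeVec_one_sub_zero_eq :
    slotTypeVec V c hGR hGR₀ hGR₁ hGR₂ hGR₃ h₁W 1 - slotTypeVec V c hGR hGR₀ hGR₁ hGR₂ hGR₃ h₁W 0 =
      pinTorusType₁ V c.D hGR h₁W - pinTorusType₀ V c.D hGR h₁W := by
  rw [slotTypeVec_sub_eq_of_arch_eigen V c hGR hGR₀ hGR₁ hGR₂ hGR₃ h₁W hpos₀ hpos₁ (boxType₀ V c.D hGR h₁W) (boxType₁ V c.D hGR h₁W)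
    (ctxSlotArchBox_harch V c hGR h₁W hpos₀ hpos₁)]
  unfold boxType₀ boxType₁
  exact add_sub_add_right_eq_sub _ _ _

include hpos₀ hpos₁ in
/-- pointwise form of the HEADLINE at a place `w` of `L`. -/
theorem slotTypeVec_one_sub_zero_apply (w : InfinitePlace (L : Type)) :
    slotTypeVec V c hGR hGR₀ hGR₁ hGR₂ hGR₃ h₁W 1 w - slotTypeVec V c hGR hGR₀ hGR₁ hGR₂ hGR₃ h₁W 0 w =
      pinTorusType₁ V c.D hGR h₁W w - pinTorusType₀ V c.D hGR h₁W w := by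
  have h := congrFun (slotTypeVec_one_sub_zero_eq V c hGR hGR₀ hGR₁ hGR₂ hGR₃ h₁W hpos₀ hpos₁) w
  simpa only [Pi.sub_apply] using h

end Vec

end HodgeCM.Model.ArchSideTerm

end
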